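import Mathlib
import Literature.RepresentationTheory.FiniteGroups.KLRGradedCellularBasis

/-!
# The NE-first inner sum of a standard Young tableau is a column-parity charge

Stub `stub_neSum_colParity` of line `klr-graded-polynomial-method` (crux
`SnSubsetDichotomy.NoThresholdSubsetTriple`, stmt-MatrixMultiplication-8302); the column twin of
`stub_swSum_rowParity`.

For a standard Young tableau `T` of shape `μ ⊢ n` (growth sequence `T.1 j = (row, col)` of the
entry `j`) and an entry `k` with cell `(r, c)` and sign `π_k = (-1)^(r + c)`:

  `Σ_{j < k, cell j strictly north-east of cell k} π_j π_k
      = π_k · Σ_{columns i > c} (−1)^i · [the prefix of column i (entries < k) is odd]`.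

Proof.  (1) For `j < k` in a column strictly right of the column of `k`, the row of `j` is
automatically strictly smaller than the row of `k` (otherwise `T.1 k ≤ T.1 j` in the product
order although `j < k`, `row_lt_of_lt_of_col_lt`), so the north-east condition is just
"column `> c`".  (2) Factor `π_k` out and split the remaining sum `Σ π_j` according to the
column `i` of `j`.  (3) In each column the entries `< k` occupy an initial segment of rows
`0, …, m - 1` (`image_rows_eq_range`), whose signed count `Σ_{row < m} (−1)^(row + i)` is
`(−1)^i [m odd]` (`colPrefix_sum`).
-/

namespace Summit.MatrixMultiplication.MatrixMultiplication.Theorems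

open Literature.NumberTheory.DiophantineGeometry (StdFilling)
open scoped BigOperators

/-- `Σ_{c < m} (−1)^c = [m odd]`. [folklore] -/
private theorem neg_one_pow_sum_range (m : ℕ) :
    ∑ c ∈ Finset.range m, (-1 : ℤ) ^ c = if Odd m then 1 else 0 := by
  induction m with
  | zero => simp
  | succ m ih =>
    rw [Finset.sum_range_succ, ih]
    rcases Nat.even_or_odd m with hm | hm
    · rw [hm.neg_one_pow, if_neg (Nat.not_odd_iff_even.2 hm), if_pos hm.add_one]
      norm_num
    · rw [hm.neg_one_pow, if_pos hm, if_neg (Nat.not_odd_iff_even.2 hm.add_one)]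
      norm_num

/-- A finite down-closed set of naturals is the initial segment of its own length. [folklore] -/
private theorem eq_range_card_of_downClosed {s : Finset ℕ}
    (h : ∀ a ∈ s, ∀ b, b < a → b ∈ s) : s = Finset.range s.card := by
  rcases s.eq_empty_or_nonempty with rfl | hne
  · simp
  · have key : s = Finset.range (s.max' hne + 1) := by
      ext c
      rw [Finset.mem_range, Nat.lt_add_one_iff]
      constructor
      · exact fun hc => s.le_max' c hc
      · intro hc
        rcases hc.eq_or_lt with rfl | hlt
        · exact s.max'_mem hne
        · exact h _ (s.max'_mem hne) _ hlt
    calc s = Finset.range (s.max' hne + 1) := key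
      _ = Finset.range s.card := by rw [congrArg Finset.card key, Finset.card_range]

/-- Every column index of a cell of a standard Young tableau of shape `μ ⊢ n` is `< n` (the row
of the cell is part of the `n` cells). [folklore] -/
private theorem col_lt {n : ℕ} {μ : Nat.Partition n} (T : StdFilling n μ.youngDiagram)
    (j : Fin n) : (T.1 j).2 < n := by
  have h : ((T.1 j).1, (T.1 j).2) ∈ μ.youngDiagram := T.mem j
  have h1 : (T.1 j).2 < μ.youngDiagram.rowLen (T.1 j).1 := YoungDiagram.mem_iff_lt_rowLen.1 h
  have h2 : μ.youngDiagram.rowLen (T.1 j).1 ≤ n := by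
    rw [YoungDiagram.rowLen_eq_card]
    calc (μ.youngDiagram.row (T.1 j).1).card ≤ μ.youngDiagram.cells.card :=
          Finset.card_le_card fun x hx =>
            (YoungDiagram.mem_cells _).2 (YoungDiagram.mem_row_iff.1 hx).1
      _ = n := μ.card_cells_youngDiagram
  exact h1.trans_le h2

/-- **Redundancy of the row condition.** In a standard Young tableau an earlier entry `j < k`
lying in a strictly larger column than `k` lies in a strictly smaller row: otherwise
`T.1 k ≤ T.1 j` in the product order, which the standardness forbids for `j < k`. [folklore] -/
private theorem row_lt_of_lt_of_col_lt {n : ℕ} {μ : Nat.Partition n}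
    (T : StdFilling n μ.youngDiagram) {j k : Fin n} (hjk : j < k)
    (hcol : (T.1 k).2 < (T.1 j).2) : (T.1 j).1 < (T.1 k).1 := by
  by_contra hle
  rw [not_lt] at hle
  exact T.not_le hjk (Prod.le_def.2 ⟨hle, hcol.le⟩)

/-- **Column prefixes are initial segments.** The rows of the entries `< k` in column `i` of a
standard Young tableau form the initial segment `0, …, m - 1`, `m` their number (the diagram is a
lower set filled bijectively and increasingly down columns). [folklore] -/
private theorem image_rows_eq_range {n : ℕ} {μ : Nat.Partition n}
    (T : StdFilling n μ.youngDiagram) (k : Fin n) (i : ℕ) :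
    (Finset.univ.filter (fun j : Fin n => j < k ∧ (T.1 j).2 = i)).image
          (fun j : Fin n => (T.1 j).1)
        = Finset.range (Finset.univ.filter (fun j : Fin n => j < k ∧ (T.1 j).2 = i)).card ∧
      Set.InjOn (fun j : Fin n => (T.1 j).1)
        ↑(Finset.univ.filter (fun j : Fin n => j < k ∧ (T.1 j).2 = i)) := by
  -- rows are injective within a column
  have hinj : Set.InjOn (fun j : Fin n => (T.1 j).1)
      ↑(Finset.univ.filter (fun j : Fin n => j < k ∧ (T.1 j).2 = i)) := by
    intro a ha b hb hab
    have ha' := (Finset.mem_filter.1 (Finset.mem_coe.1 ha)).2.2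
    have hb' := (Finset.mem_filter.1 (Finset.mem_coe.1 hb)).2.2
    exact T.injective (Prod.ext hab (ha'.trans hb'.symm))
  -- the set of rows is down-closed
  have hlow : ∀ a ∈ (Finset.univ.filter (fun j : Fin n => j < k ∧ (T.1 j).2 = i)).image
      (fun j : Fin n => (T.1 j).1), ∀ b, b < a →
      b ∈ (Finset.univ.filter (fun j : Fin n => j < k ∧ (T.1 j).2 = i)).image
        (fun j : Fin n => (T.1 j).1) := by
    intro a ha b hba
    obtain ⟨j, hj, rfl⟩ := Finset.mem_image.1 ha
    obtain ⟨hjk, hji⟩ := (Finset.mem_filter.1 hj).2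
    have hzle : (b, i) ≤ T.1 j := Prod.le_def.2 ⟨hba.le, hji.ge⟩
    have hz : (b, i) ∈ μ.youngDiagram := μ.youngDiagram.isLowerSet hzle (T.mem j)
    obtain ⟨m, hm⟩ := T.exists_eq μ.card_cells_youngDiagram hz
    have hmj : m < j := by
      by_contra hnot
      rcases (not_lt.1 hnot).lt_or_eq with hlt | heq
      · exact T.not_le hlt (hm.le.trans hzle)
      · subst heq
        exact absurd (congrArg Prod.fst hm) (ne_of_gt hba)
    exact Finset.mem_image.2
      ⟨m, Finset.mem_filter.2 ⟨Finset.mem_univ _, hmj.trans hjk, congrArg Prod.snd hm⟩,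
        congrArg Prod.fst hm⟩
  refine ⟨?_, hinj⟩
  rw [← Finset.card_image_of_injOn hinj]
  exact eq_range_card_of_downClosed hlow

/-- **Signed count of a column prefix.** The entries `< k` in column `i` contribute
`Σ (−1)^(row + i) = (−1)^i [their number is odd]`. [folklore] -/
private theorem colPrefix_sum {n : ℕ} {μ : Nat.Partition n} (T : StdFilling n μ.youngDiagram)
    (k : Fin n) (i : ℕ) :
    ∑ j ∈ Finset.univ.filter (fun j : Fin n => j < k ∧ (T.1 j).2 = i),
        (-1 : ℤ) ^ ((T.1 j).1 + (T.1 j).2) =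
      if Odd ((Finset.univ.filter (fun j : Fin n => j < k ∧ (T.1 j).2 = i)).card)
      then (-1 : ℤ) ^ i else 0 := by
  obtain ⟨himg, hinj⟩ := image_rows_eq_range T k i
  calc ∑ j ∈ Finset.univ.filter (fun j : Fin n => j < k ∧ (T.1 j).2 = i),
        (-1 : ℤ) ^ ((T.1 j).1 + (T.1 j).2)
      = ∑ j ∈ Finset.univ.filter (fun j : Fin n => j < k ∧ (T.1 j).2 = i),
          (-1 : ℤ) ^ i * (-1 : ℤ) ^ (T.1 j).1 := by
        refine Finset.sum_congr rfl fun j hj => ?_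
        rw [(Finset.mem_filter.1 hj).2.2, pow_add, mul_comm]
    _ = (-1 : ℤ) ^ i *
          ∑ r ∈ (Finset.univ.filter (fun j : Fin n => j < k ∧ (T.1 j).2 = i)).image
            (fun j : Fin n => (T.1 j).1), (-1 : ℤ) ^ r := by
        rw [Finset.mul_sum, Finset.sum_image hinj]
    _ = if Odd ((Finset.univ.filter (fun j : Fin n => j < k ∧ (T.1 j).2 = i)).card)
        then (-1 : ℤ) ^ i else 0 := by
        rw [himg, neg_one_pow_sum_range]
        split_ifs <;> simp

set_option linter.dupNamespace false in -- deliberate Summit.<S>.<P> duplicate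
/-- **Stub `stub_neSum_colParity` (line `klr-graded-polynomial-method`, crux
`SnSubsetDichotomy.NoThresholdSubsetTriple`, stmt-MatrixMultiplication-8302): the NE-first inner
sum is `π_k` times the alternating column-parity charge right of the column of `k`.**  For a
standard Young tableau `T` of shape `μ ⊢ n` and an entry `k` with cell `(r, c)`,
`π_x = (−1)^(row + col)`:
`Σ_{j < k, cell j strictly NE of cell k} π_j π_k = π_k Σ_{i > c} (−1)^i [#{j < k in column i} odd]`.
Indeed the row condition is redundant (`row_lt_of_lt_of_col_lt`), `π_j π_k = π_k π_j`, and
column by column the entries `< k` fill an initial segment of rows, of signed count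
`(−1)^i [odd length]` (`colPrefix_sum`).  Column twin of `stub_swSum_rowParity`. [folklore] -/
theorem stub_neSum_colParity : ∀ (n : ℕ) (μ : Nat.Partition n) (T : StdFilling n μ.youngDiagram) (k : Fin n), ∑ j ∈ Finset.univ.filter (fun j : Fin n => j < k ∧ (T.1 j).1 < (T.1 k).1 ∧ (T.1 k).2 < (T.1 j).2), (-1 : ℤ) ^ ((T.1 j).1 + (T.1 j).2 + (T.1 k).1 + (T.1 k).2) = (-1 : ℤ) ^ ((T.1 k).1 + (T.1 k).2) * ∑ i ∈ Finset.range n, (if (T.1 k).2 < i ∧ Odd ((Finset.univ.filter (fun j : Fin n => j < k ∧ (T.1 j).2 = i)).card) then (-1 : ℤ) ^ i else 0) := by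
  intro n μ T k
  -- (1) the row condition is redundant
  have hF : Finset.univ.filter
        (fun j : Fin n => j < k ∧ (T.1 j).1 < (T.1 k).1 ∧ (T.1 k).2 < (T.1 j).2) =
      Finset.univ.filter (fun j : Fin n => j < k ∧ (T.1 k).2 < (T.1 j).2) :=
    Finset.filter_congr fun j _ =>
      ⟨fun h => ⟨h.1, h.2.2⟩, fun h => ⟨h.1, row_lt_of_lt_of_col_lt T h.1 h.2, h.2⟩⟩
  -- (2) factor the sign of `k`
  have hsign : ∀ j : Fin n, (-1 : ℤ) ^ ((T.1 j).1 + (T.1 j).2 + (T.1 k).1 + (T.1 k).2) =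
      (-1 : ℤ) ^ ((T.1 k).1 + (T.1 k).2) * (-1 : ℤ) ^ ((T.1 j).1 + (T.1 j).2) := by
    intro j
    rw [add_assoc, pow_add, mul_comm]
  rw [hF, Finset.sum_congr rfl fun j _ => hsign j, ← Finset.mul_sum]
  congr 1
  -- (3) split according to the column of `j`
  have hmaps : ∀ j ∈ Finset.univ.filter (fun j : Fin n => j < k ∧ (T.1 k).2 < (T.1 j).2),
      (T.1 j).2 ∈ Finset.range n := fun j _ => Finset.mem_range.2 (col_lt T j)
  rw [← Finset.sum_fiberwise_of_maps_to hmaps]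
  refine Finset.sum_congr rfl fun i _ => ?_
  rw [Finset.filter_filter]
  by_cases hi : (T.1 k).2 < i
  · have hfilt : Finset.univ.filter
          (fun j : Fin n => (j < k ∧ (T.1 k).2 < (T.1 j).2) ∧ (T.1 j).2 = i) =
        Finset.univ.filter (fun j : Fin n => j < k ∧ (T.1 j).2 = i) :=
      Finset.filter_congr fun j _ =>
        ⟨fun h => ⟨h.1.1, h.2⟩, fun h => ⟨⟨h.1, hi.trans_eq h.2.symm⟩, h.2⟩⟩
    rw [hfilt, colPrefix_sum T k i]
    simp only [hi, true_and]
  · have hfilt : Finset.univ.filter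
          (fun j : Fin n => (j < k ∧ (T.1 k).2 < (T.1 j).2) ∧ (T.1 j).2 = i) = ∅ :=
      Finset.filter_eq_empty_iff.2 fun j _ h => hi (h.1.2.trans_eq h.2)
    rw [hfilt, Finset.sum_empty, if_neg (fun h => hi h.1)]

end Summit.MatrixMultiplication.MatrixMultiplication.Theorems
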